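import Summits.CriticalPhenomena.CardyFormulaZ2.Theorems.CardyIKTransportIKMixedBoxCrossingQuenchedSquaresFromTall
import Summits.CriticalPhenomena.CardyFormulaZ2.Theorems.CardyIKTransportIKMixedBoxCrossingQuenchedHarris7
import Summits.CriticalPhenomena.CardyFormulaZ2.Theorems.CardyIKTransportIKMixedBoxCrossingQuenchedRSWAssembly
import Summits.CriticalPhenomena.CardyFormulaZ2.Theorems.CardyIKTransportIKMixedBoxCrossingStubMonotone

/-!
# Line `defect-closure-exploration` v8 — THE RESIDUE IS EXACTLY S4: given approximate Harris, the crux's horizontal clause,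
# the isotropy floor and the tall-easy-transverse floor are EQUIVALENT (crux `IKMixedBoxCrossing`, stmt-CriticalPhenomena-5911; lead c7)

With `ApproxHarrisFam` (the quenched-concentration layer) available, the three anisotropy statements of the line coincide:
`Split.HorizontalClause ↔ IsotropyFloorAll ↔ TallEasyTransverse`.  The implications `TallEasyTransverse → IsotropyFloorAll`
(`stub_squaresFromTall`, the ladder) and `IsotropyFloorAll → Split.HorizontalClause` (`stub_rswAssembly` with `stub_harris7OfFam`) are
the landed RSW assemblies; the converse directions are elementary: a left–right crossing of the `2n × n` box restricts to one of its left
`n × n` square (width antitonicity `Monotone'`, landed `stub_monotone`), and squares are tall boxes with `K₀ = 1` (`tallEasy_of_isotropyFloorAll`).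
So, modulo `ApproxHarrisFam`, `TallEasyTransverse` is not merely sufficient for the crux but NECESSARY: it is the crux's exact residue.
-/

namespace Summit.CriticalPhenomena.CardyFormulaZ2.Cruxes.IKMixedBoxCrossing.QuenchedChainFKG

open Summit.CriticalPhenomena.CardyFormulaZ2.Cruxes.IKMixedBoxCrossing.PairedMirrorExploration (pLR stub_monotone)

/-- The crux's horizontal clause gives the isotropy floor: an LR crossing of `[a, a+2n) × [b, b+n)` contains one of the square
`[a, a+n) × [b, b+n)` (width antitonicity of `pLR`). -/
theorem isotropyFloorAll_of_horizontalClause (h : Split.HorizontalClause) : IsotropyFloorAll := by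
  obtain ⟨c, hc, hcross⟩ := Split.horizontalClause_iff.1 h
  refine ⟨c, hc, fun S n hn a b => ?_⟩
  calc c ≤ pLR S a b (2 * n) n := hcross S n hn a b
    _ ≤ pLR S a b n n := stub_monotone.1 S a b n (2 * n) n hn (by omega)

/-- **The residue is exactly S4.**  Given `ApproxHarrisFam`, the crux's horizontal clause is EQUIVALENT to `TallEasyTransverse`. -/
theorem horizontalClause_iff_tallEasyTransverse : ApproxHarrisFam → (Split.HorizontalClause ↔ TallEasyTransverse) :=
  fun hF => ⟨fun h => tallEasy_of_isotropyFloorAll (isotropyFloorAll_of_horizontalClause h),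
    fun hT => stub_rswAssembly (stub_squaresFromTall hT hF) (stub_harris7OfFam hF)⟩

/-- Given `ApproxHarrisFam`, the crux's horizontal clause is EQUIVALENT to the isotropy floor. -/
theorem horizontalClause_iff_isotropyFloorAll (hF : ApproxHarrisFam) : Split.HorizontalClause ↔ IsotropyFloorAll :=
  ⟨isotropyFloorAll_of_horizontalClause, fun hI => stub_rswAssembly hI (stub_harris7OfFam hF)⟩

/-- Given `ApproxHarrisFam`, the crux itself (home-route decl) is EQUIVALENT to `TallEasyTransverse`. -/
theorem iKMixedBoxCrossing_iff_tallEasyTransverse (hF : ApproxHarrisFam) :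
    Summit.CriticalPhenomena.CardyFormulaZ2.Theses.CardyDiluteOrbit.IKMixedBoxCrossing ↔ TallEasyTransverse :=
  Split.iKMixedBoxCrossing_iff_horizontal.trans (horizontalClause_iff_tallEasyTransverse hF)

end Summit.CriticalPhenomena.CardyFormulaZ2.Cruxes.IKMixedBoxCrossing.QuenchedChainFKG
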